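import Literature.Topology.FourManifolds.SmallSetComplement
import Mathlib.Analysis.Calculus.ContDiff.Operations
import HarnessLib

/-!
# Sets covered by countably many `C¹` images of `ℝᵏ`: a general-position smallness class

Topic `Literature/Topology/Euclidean`. A robust substitute for "the image of a `k`-dimensional
cell under a piecewise smooth map" in general-position arguments (Hatcher, *Algebraic Topology*
(2002), §4.1, proof of Thm. 4.8 / Lemma 4.10: the image of a lower-dimensional cell misses a
point of each higher-dimensional open cell): a subset `A` of a normed space is
**`k`-`C¹`-covered** if it is contained in a countable union of images of open subsets of
`ℝᵏ = Fin k → ℝ` under maps that are `C¹` on those open sets. This class is closed under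
subsets, countable unions, images under maps that are *branchwise* `C¹` (at each point of `A`
the map agrees with one of countably many `C¹` maps defined near it — e.g. radial projections
in a cube, which are smooth off finitely many hyperplanes), and cones raise `k` by one; and a
`k`-`C¹`-covered set has Hausdorff dimension `≤ k` (the tree's
`Literature.Topology.FourManifolds.SmallSet.dimH_le_finrank_of_subset_iUnion`), so it never
contains an open subset of an `m`-dimensional cube for `m > k`.

* `IsC1Covered k A`; `.mono`, `.empty`, `.union`, `isC1Covered_of_cover` (re-indexing),
  `isC1Covered_iUnion`, `isC1Covered_singleton`, `isC1Covered_of_finite`;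
* `IsC1Covered.image_of_branches`, `IsC1Covered.cone`;
* `IsC1Covered.dimH_le`, `IsC1Covered.not_image_ball_subset`.

No `sorry`; [folklore].

## References

* A. Hatcher, *Algebraic Topology*, CUP (2002), §4.1, Thm. 4.8 and Lemma 4.10 (cellular
  approximation by general position). [HatcherAT2002]
-/

noncomputable section

open Set Metric Topology Function
open scoped ENNReal

namespace Literature.Topology.Euclidean

variable {E : Type*} [NormedAddCommGroup E] [NormedSpace ℝ E]
  {E' : Type*} [NormedAddCommGroup E'] [NormedSpace ℝ E']

/-- **`A` is `k`-`C¹`-covered**: `A` lies in a countable union of images `fᵢ(Wᵢ)` of open sets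
`Wᵢ ⊆ ℝᵏ` under maps `fᵢ` of class `C¹` on `Wᵢ`. [folklore] -/
def IsC1Covered (k : ℕ) (A : Set E) : Prop :=
  ∃ (ι : Type) (_ : Countable ι) (f : ι → (Fin k → ℝ) → E) (W : ι → Set (Fin k → ℝ)),
    (∀ i, IsOpen (W i)) ∧ (∀ i, ContDiffOn ℝ 1 (f i) (W i)) ∧ A ⊆ ⋃ i, f i '' W i

namespace IsC1Covered

variable {k : ℕ} {A B : Set E}

/-- Subsets of covered sets are covered. [folklore] -/
theorem mono (hB : IsC1Covered k B) (hAB : A ⊆ B) : IsC1Covered k A := by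
  obtain ⟨ι, hι, f, W, hW, hf, hcov⟩ := hB
  exact ⟨ι, hι, f, W, hW, hf, hAB.trans hcov⟩

/-- The empty set is covered. [folklore] -/
theorem empty (k : ℕ) : IsC1Covered k (∅ : Set E) :=
  ⟨PEmpty, inferInstance, fun i => i.elim, fun i => i.elim, fun i => i.elim, fun i => i.elim,
    empty_subset _⟩

end IsC1Covered

/-- **Re-indexing**: a cover indexed by any countable type gives `IsC1Covered` (whose index
type lives in `Type`): encode the index injectively into `ℕ`. [folklore] -/
theorem isC1Covered_of_cover {k : ℕ} {A : Set E} {σ : Type*} [Countable σ]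
    (f : σ → (Fin k → ℝ) → E) (W : σ → Set (Fin k → ℝ)) (hW : ∀ s, IsOpen (W s))
    (hf : ∀ s, ContDiffOn ℝ 1 (f s) (W s)) (hcov : A ⊆ ⋃ s, f s '' W s) : IsC1Covered k A := by
  obtain ⟨enc, henc⟩ := Countable.exists_injective_nat σ
  let dec : ↥(Set.range enc) → σ := fun n => Classical.choose n.2
  have hdec : ∀ s : σ, dec ⟨enc s, s, rfl⟩ = s := fun s =>
    henc (Classical.choose_spec (⟨s, rfl⟩ : enc s ∈ Set.range enc))
  refine ⟨↥(Set.range enc), inferInstance, fun n => f (dec n), fun n => W (dec n),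
    fun n => hW _, fun n => hf _, fun x hx => ?_⟩
  obtain ⟨s, hs⟩ := mem_iUnion.1 (hcov hx)
  refine mem_iUnion.2 ⟨⟨enc s, s, rfl⟩, ?_⟩
  show x ∈ f (dec ⟨enc s, s, rfl⟩) '' W (dec ⟨enc s, s, rfl⟩)
  rw [hdec s]
  exact hs

/-- **Countable unions of covered sets are covered.** [folklore] -/
theorem isC1Covered_iUnion {k : ℕ} {J : Type*} [Countable J] {A : J → Set E}
    (hA : ∀ j, IsC1Covered k (A j)) : IsC1Covered k (⋃ j, A j) := by
  choose ι hι f W hW hf hcov using hA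
  refine isC1Covered_of_cover (σ := Σ j, ι j) (fun σ => f σ.1 σ.2) (fun σ => W σ.1 σ.2)
    (fun σ => hW _ _) (fun σ => hf _ _) fun x hx => ?_
  obtain ⟨j, hxj⟩ := mem_iUnion.1 hx
  obtain ⟨i, hxi⟩ := mem_iUnion.1 (hcov j hxj)
  exact mem_iUnion.2 ⟨⟨j, i⟩, hxi⟩

/-- Unions of two covered sets are covered. [folklore] -/
theorem IsC1Covered.union {k : ℕ} {A B : Set E} (hA : IsC1Covered k A) (hB : IsC1Covered k B) :
    IsC1Covered k (A ∪ B) := by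
  rw [union_eq_iUnion]
  exact isC1Covered_iUnion fun b => by cases b <;> assumption

/-- Points are covered (in every dimension `k`). [folklore] -/
theorem isC1Covered_singleton (k : ℕ) (x : E) : IsC1Covered k ({x} : Set E) :=
  ⟨Unit, inferInstance, fun _ _ => x, fun _ => univ, fun _ => isOpen_univ,
    fun _ => contDiffOn_const, by
      intro y hy
      rw [mem_singleton_iff.1 hy]
      exact mem_iUnion.2 ⟨(), ⟨0, mem_univ _, rfl⟩⟩⟩

/-- Finite sets are covered. [folklore] -/
theorem isC1Covered_of_finite {k : ℕ} {A : Set E} (hA : A.Finite) : IsC1Covered k A := by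
  have : A = ⋃ x : A, {(x : E)} := by ext y; simp
  rw [this]
  haveI : Countable A := hA.countable.to_subtype
  exact isC1Covered_iUnion fun x => isC1Covered_singleton k (x : E)

/-- **Images under branchwise `C¹` maps are covered**: if at each point of `A` the map `Ψ`
agrees with one of countably many maps `ψⱼ`, each `C¹` on an open set `Oⱼ` containing the
point, then `Ψ(A)` is covered (in the same dimension). [folklore] -/
theorem IsC1Covered.image_of_branches {k : ℕ} {A : Set E} (hA : IsC1Covered k A)
    {J : Type*} [Countable J] (Ψ : E → E') (ψ : J → E → E') (O : J → Set E)
    (hO : ∀ j, IsOpen (O j)) (hψ : ∀ j, ContDiffOn ℝ 1 (ψ j) (O j))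
    (hbr : ∀ a ∈ A, ∃ j, a ∈ O j ∧ Ψ a = ψ j a) : IsC1Covered k (Ψ '' A) := by
  obtain ⟨ι, hι, f, W, hW, hf, hcov⟩ := hA
  refine isC1Covered_of_cover (σ := ι × J) (fun p => ψ p.2 ∘ f p.1)
    (fun p => W p.1 ∩ f p.1 ⁻¹' O p.2) (fun p => ?_) (fun p => ?_) ?_
  · exact (hf p.1).continuousOn.isOpen_inter_preimage (hW p.1) (hO _)
  · exact (hψ _).comp ((hf p.1).mono inter_subset_left) fun x hx => hx.2
  · rintro _ ⟨a, ha, rfl⟩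
    obtain ⟨j, haj, hΨ⟩ := hbr a ha
    obtain ⟨i, hi⟩ := mem_iUnion.1 (hcov ha)
    obtain ⟨w, hw, rfl⟩ := hi
    exact mem_iUnion.2 ⟨(i, j), w, ⟨hw, haj⟩, hΨ.symm⟩

/-- **Cones raise the covering dimension by one**: the cone
`{z + t (a - z) | a ∈ A, t ∈ ℝ}` over a `k`-covered set is `(k + 1)`-covered. [folklore] -/
theorem IsC1Covered.cone {k : ℕ} {A : Set E} (hA : IsC1Covered k A) (z : E) :
    IsC1Covered (k + 1) ((fun q : E × ℝ => z + q.2 • (q.1 - z)) '' (A ×ˢ univ)) := by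
  obtain ⟨ι, hι, f, W, hW, hf, hcov⟩ := hA
  have hinit : ContDiff ℝ 1 fun v : Fin (k + 1) → ℝ => (Fin.init v : Fin k → ℝ) :=
    contDiff_pi.2 fun i => contDiff_apply ℝ ℝ i.castSucc
  have hlast : ContDiff ℝ 1 fun v : Fin (k + 1) → ℝ => v (Fin.last k) := contDiff_apply ℝ ℝ _
  refine ⟨ι, hι, fun i v => z + v (Fin.last k) • (f i (Fin.init v) - z),
    fun i => (fun v : Fin (k + 1) → ℝ => (Fin.init v : Fin k → ℝ)) ⁻¹' W i,
    fun i => (hW i).preimage hinit.continuous, fun i => ?_, ?_⟩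
  · exact contDiffOn_const.add (hlast.contDiffOn.smul
      (((hf i).comp hinit.contDiffOn fun v hv => hv).sub contDiffOn_const))
  · rintro _ ⟨⟨a, t⟩, ⟨ha, -⟩, rfl⟩
    obtain ⟨i, hi⟩ := mem_iUnion.1 (hcov ha)
    obtain ⟨w, hw, rfl⟩ := hi
    refine mem_iUnion.2 ⟨i, Fin.snoc w t, ?_, ?_⟩
    · show (Fin.init (Fin.snoc w t : Fin (k + 1) → ℝ) : Fin k → ℝ) ∈ W i
      rw [Fin.init_snoc]; exact hw
    · simp only [Fin.init_snoc, Fin.snoc_last]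

/-- **A `k`-covered set has Hausdorff dimension `≤ k`.** [folklore] -/
theorem IsC1Covered.dimH_le {k : ℕ} {A : Set E} (hA : IsC1Covered k A) : dimH A ≤ k := by
  obtain ⟨ι, hι, f, W, hW, hf, hcov⟩ := hA
  have h := Literature.Topology.FourManifolds.SmallSet.dimH_le_finrank_of_subset_iUnion
    (P := Fin k → ℝ) f W hW hf hcov
  simpa [Module.finrank_fin_fun] using h

/-- **Covered sets are nowhere dense in higher dimension**: if `A` is `k`-covered, `k < m`, and
`φ : ℝᵐ → E` has a left inverse `χ` (`χ (φ y) = y` on the open unit ball) which is Lipschitz on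
the image `φ(ball 0 1)`, then `φ(ball 0 1)` is not contained in `A` (its Hausdorff dimension is
`m > k`). [folklore] -/
theorem IsC1Covered.not_image_ball_subset {k m : ℕ} {A : Set E} (hA : IsC1Covered k A)
    (hkm : k < m) {φ : (Fin m → ℝ) → E} {χ : E → (Fin m → ℝ)} {L : NNReal}
    (hχ : LipschitzOnWith L χ (φ '' ball 0 1)) (hφχ : ∀ y ∈ ball (0 : Fin m → ℝ) 1, χ (φ y) = y) :
    ¬ (φ '' ball 0 1 ⊆ A) := by
  intro hsub
  have h1 : dimH (ball (0 : Fin m → ℝ) 1) = m := Real.dimH_ball_pi_fin 0 one_pos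
  have h2 : (ball (0 : Fin m → ℝ) 1) = χ '' (φ '' ball 0 1) := by
    rw [image_image]
    ext y
    constructor
    · intro hy; exact ⟨y, hy, hφχ y hy⟩
    · rintro ⟨y', hy', rfl⟩
      show χ (φ y') ∈ ball (0 : Fin m → ℝ) 1
      rw [hφχ y' hy']; exact hy'
  have h3 : dimH (ball (0 : Fin m → ℝ) 1) ≤ dimH A :=
    calc dimH (ball (0 : Fin m → ℝ) 1) = dimH (χ '' (φ '' ball 0 1)) := by rw [← h2]
      _ ≤ dimH (φ '' ball 0 1) := hχ.dimH_image_le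
      _ ≤ dimH A := dimH_mono hsub
  have h4 : (m : ℝ≥0∞) ≤ k := (h1.symm.trans_le h3).trans hA.dimH_le
  exact absurd (by exact_mod_cast h4 : m ≤ k) (by omega)

end Literature.Topology.Euclidean

end
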